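import Literature.MathematicalPhysics.KineticTheory.HardSphereEulerPrimitiveForm
import HarnessLib

/-!
# The frozen-coefficient energy identity of the hard-sphere Euler system on `𝕋³` and the
# relative-energy balance between solutions with two equations of state

MathematicalPhysics/KineticTheory proof file (theorems only; no definitions, no named facts),
sequel of `HardSphereEulerPrimitiveForm.lean`, first file of LAYER 4 (the fixed-horizon a-priori
`H³` stability estimate, T. Kato, ARMA 58 (1975) §§3–4 / A. Majda 1984 Ch. 2, proof of
Thms 2.1–2.2: energy method at every derivative level for the symmetrised quasilinear system) of
the proof of `hsEuler_continuousDependence` (`HardSphereEulerContinuousDependenceProofs.lean`).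
Fix ONE classical solution `V = (ρ, u, θ)` (`IsHardSphereEulerSolution σ T ρ u θ`) whose pressure
field is `ρ θ ζ(ρ)` (`ζ` smooth on an open `J ⊇ ρ([0, T) × 𝕋³)`; `γ = ζ + id·ζ'`, Friedrichs
weights `A = θ γ(ρ)/ρ`, `B = 3ρ/(2θ)`). The linearisation of the primitive system around `V`
with FROZEN coefficients acts on a triple `W = (α, w, β)` by
`F_ρ W = ∂ₜα + u·∇α + ρ div w`, `(F_u W)ⱼ = ∂ₜwⱼ + u·∇wⱼ + A ∂ⱼα + ζ(ρ) ∂ⱼβ`,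
`F_θ W = ∂ₜβ + u·∇β + (2/3) θ ζ(ρ) div w` (`∂ₜ = Torus.timeDerivWithin (Ico 0 T)`,
`∂ᵢ = Torus.partialDeriv i`). Everything below is in the namespace `HsEulerStability` (generic
helpers in `HsEulerCalc`).

* `HsEulerCalc.torus_transport_energy_identity(_norm_sq)`, `HsEulerCalc.torus_symm_flux_identity`
  — Leibniz bookkeeping: `∂ₜ(w X²) + Σᵢ ∂ᵢ(w X² uᵢ) = (D_t w + w div u) X² + 2 w X D_t X`
  (scalar and inner-product-space valued `X`), `∂ᵢ(c X Y) = (∂ᵢc) X Y + c (∂ᵢX Y + X ∂ᵢY)`;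
* `hsEuler_coeffRho_partialDeriv`, `hsEuler_coeffTheta_partialDeriv`, `hsEuler_weightA_transport`,
  `hsEuler_weightB_transport` — the zero-order coefficients made explicit:
  `∂ᵢ(θγ(ρ)) = ∂ᵢθ γ + θ(2ζ' + ρζ'')∂ᵢρ`, `∂ᵢ(ρζ(ρ)) = γ ∂ᵢρ`,
  `D_tA + A div u = (A(2 - (2/3)ζ) - θ(2ζ' + ρζ'')) div u`, `D_tB + B div u = (2/3)ζ B div u`;
* `hsEuler_frozen_energy_identity` — for ARBITRARY jointly smooth `W = (α, w, β)` the pointwise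
  identity `∂ₜe + Σᵢ ∂ᵢΦᵢ = Q + A α F_ρW + ρ Σⱼ wⱼ (F_uW)ⱼ + B β F_θW`,
  `e = ½ (A α² + ρ |w|² + B β²)`, `Φᵢ = ½ (A uᵢ α² + ρ uᵢ |w|² + B uᵢ β²) + θγ(ρ) α wᵢ + ρζ(ρ) β wᵢ`,
  with the explicit quadratic form `Q` (only the mass equation and `ρ, θ > 0` are used);
  `hsEuler_frozen_energy_identity_explicit` — the same with the coefficients of `Q` evaluated;
  `isSmoothSpaceTimeOn_frozenEnergy/Flux` — `e`, `Φᵢ` are jointly smooth;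
* `hsEuler_relativeEnergy_balance_two_eos` — for `W = V - V'` with `V'` a classical solution of
  the system with ANOTHER pressure law `ρ' θ' ζ₂(ρ')` (in layer 4: the ideal gas, `ζ₂ ≡ 1`,
  `σ' = 0`) the frozen operator of the difference is evaluated through the primitive equations of
  both systems: `F_ρ = -(α div u' + w·∇ρ')`,
  `F_uⱼ = -(w·∇u'ⱼ + (θγ(ρ)/ρ - θ'γ₂(ρ')/ρ') ∂ⱼρ' + (ζ(ρ) - ζ₂(ρ')) ∂ⱼθ')`,
  `F_θ = -(w·∇θ' + (2/3)(θζ(ρ) - θ'ζ₂(ρ')) div u')` — bilinear in the differences and the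
  reference gradients, forced only by the equation-of-state defects.

Ported from the summit-side helper files `Summits/AtomisticToContinuum/HydrodynamicLimit/Theorems/
ImplosionDichotomyPolynomialCompression{TransportIdentity,WeightTransport,FrozenEnergyIdentity,
RelativeEnergyTwoEos}.lean` (Literature may not import Summits, CONVENTIONS §2; the summit copies
become the redundant ones; short names are kept verbatim inside the namespace `HsEulerStability`,
which the summit files do not open, so nothing clashes).

## Mathlib / tree search

Tree: `HardSphereEulerPrimitiveForm.lean` (primitive equations, `HsEulerCalc` point calculus),
`Torus.IsSmoothSpaceTimeOn.{hasDerivWithinAt_slice, partialDeriv, timeDerivWithin}`,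
`Torus.hasDerivAt_comp_add_proj_smul`. Mathlib: `HasDerivAt.fun_mul`, `HasDerivWithinAt.inner`,
`linear_combination`, `field_simp`.

## References

* T. Kato, *The Cauchy problem for quasi-linear symmetric hyperbolic systems*, Arch. Rational
  Mech. Anal. 58 (1975) 181–205, §§3–4. [`Kato1975`]
* A. Majda, *Compressible Fluid Flow and Systems of Conservation Laws in Several Space
  Variables*, Appl. Math. Sci. 53, Springer 1984: Ch. 2, §2.1, proof of Thm 2.1 (the symmetrised
  energy identity at every derivative level). [`Majda1984`]
* C. M. Dafermos, *Hyperbolic Conservation Laws in Continuum Physics*, 2nd ed. (2005), Ch. V,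
  §5.2–5.3 (relative entropy / energy between solutions). [`Dafermos2005`]
-/

noncomputable section

open Set Filter MeasureTheory
open _root_.Topology
open scoped ContDiff InnerProductSpace

namespace Literature.MathematicalPhysics.KineticTheory

open Literature.Analysis.FunctionSpaces
open HsEulerCalc

namespace HsEulerCalc

/-- **Symmetric flux identity.** For `C¹` scalar functions `c, X, Y` on `𝕋³`, `i : Fin 3` and
`x ∈ 𝕋³`, `∂ᵢ(c X Y)(x) = ∂ᵢc(x) X(x) Y(x) + c(x) (∂ᵢX(x) Y(x) + X(x) ∂ᵢY(x))`: the cross terms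
`c (∂ᵢX · Y + X · ∂ᵢY)` of a symmetrised first-order system are a divergence up to the
zero-order term `-(∂ᵢc) X Y`. [folklore] -/
theorem torus_symm_flux_identity :
    ∀ {c X Y : T3 → ℝ}, Torus.IsContDiff 1 c → Torus.IsContDiff 1 X → Torus.IsContDiff 1 Y →
      ∀ (i : Fin 3) (x : T3),
        Torus.partialDeriv i (fun y => c y * X y * Y y) x =
          Torus.partialDeriv i c x * X x * Y x +
            c x * (Torus.partialDeriv i X x * Y x + X x * Torus.partialDeriv i Y x) := by
  intro c X Y hc hX hY i x
  exact partialDeriv_eq_of_hasDerivAt ((((hasDerivAt_coordLine hc x i).fun_mul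
    (hasDerivAt_coordLine hX x i)).fun_mul (hasDerivAt_coordLine hY x i)).congr_deriv
    (by simp only [zero_smul, Torus.proj_zero, add_zero]; ring))

/-- **Transport energy identity (scalar).** For jointly smooth scalar fields `w, X` and a jointly
smooth velocity field `u` on `[0, T) × 𝕋³`, at every `t ∈ [0, T)` and `x ∈ 𝕋³`,
`∂ₜ(w X²) + Σᵢ ∂ᵢ(w X² uᵢ) = (∂ₜw + Σᵢ uᵢ ∂ᵢw + w Σᵢ ∂ᵢuᵢ) X² + 2 w X (∂ₜX + Σᵢ uᵢ ∂ᵢX)`, i.e.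
`∂ₜe + div(e u) = (D_t w + w div u) X² + 2 w X D_t X` for the weighted square `e = w X²`
(`∂ₜ` the one-sided time derivative within `Ico 0 T`). [folklore] -/
theorem torus_transport_energy_identity :
    ∀ {T : ℝ} {w X : ℝ → T3 → ℝ} {u : ℝ → T3 → V3},
      Torus.IsSmoothSpaceTimeOn (Ico 0 T) w → Torus.IsSmoothSpaceTimeOn (Ico 0 T) X →
      Torus.IsSmoothSpaceTimeOn (Ico 0 T) u → ∀ {t : ℝ}, t ∈ Ico 0 T → ∀ x : T3,
        Torus.timeDerivWithin (Ico 0 T) (fun s y => w s y * X s y ^ 2) t x +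
            ∑ i, Torus.partialDeriv i (fun y => w t y * X t y ^ 2 * u t y i) x =
          (Torus.timeDerivWithin (Ico 0 T) w t x + ∑ i, u t x i * Torus.partialDeriv i (w t) x +
                w t x * ∑ i, Torus.partialDeriv i (fun y => u t y i) x) * X t x ^ 2 +
            2 * w t x * X t x * (Torus.timeDerivWithin (Ico 0 T) X t x +
              ∑ i, u t x i * Torus.partialDeriv i (X t) x) := by
  intro T w X u hw hX hu t ht x
  have hU : UniqueDiffOn ℝ (Ico (0 : ℝ) T) := uniqueDiffOn_Ico 0 T
  have hw1 : Torus.IsContDiff 1 (w t) := (hw.isSmooth_slice ht).isContDiff (by simp)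
  have hX1 : Torus.IsContDiff 1 (X t) := (hX.isSmooth_slice ht).isContDiff (by simp)
  have hu1 : Torus.IsContDiff 1 (u t) := (hu.isSmooth_slice ht).isContDiff (by simp)
  have huj1 : ∀ i, Torus.IsContDiff 1 (fun y => u t y i) := fun i => isContDiff_apply_coord hu1 i
  -- (1) the one-sided time derivative of `w X²`
  rw [timeDerivWithin_eq_of_hasDerivWithinAt ((hw.hasDerivWithinAt_slice ht x).fun_mul
    ((hX.hasDerivWithinAt_slice ht x).fun_pow 2)) (hU t ht)]
  -- (2) the divergence of the flux `w X² uᵢ`, coordinate by coordinate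
  have hΦ : ∀ i, Torus.partialDeriv i (fun y => w t y * X t y ^ 2 * u t y i) x =
      (Torus.partialDeriv i (w t) x * X t x ^ 2 +
          w t x * (2 * X t x * Torus.partialDeriv i (X t) x)) * u t x i +
        w t x * X t x ^ 2 * Torus.partialDeriv i (fun y => u t y i) x := by
    intro i
    exact partialDeriv_eq_of_hasDerivAt ((((hasDerivAt_coordLine hw1 x i).fun_mul
      ((hasDerivAt_coordLine hX1 x i).fun_pow 2)).fun_mul
      (hasDerivAt_coordLine (huj1 i) x i)).congr_deriv
      (by simp only [zero_smul, Torus.proj_zero, add_zero]; ring))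
  simp only [hΦ, Fin.sum_univ_three]
  ring

/-- **Transport energy identity (vector-valued).** For a jointly smooth scalar weight `w`, a
jointly smooth field `X` with values in a real inner product space `E` and a jointly smooth
velocity field `u` on `[0, T) × 𝕋³`, at every `t ∈ [0, T)` and `x ∈ 𝕋³`,
`∂ₜ(w ‖X‖²) + Σᵢ ∂ᵢ(w ‖X‖² uᵢ) = (∂ₜw + Σᵢ uᵢ ∂ᵢw + w Σᵢ ∂ᵢuᵢ) ‖X‖² + 2 w ⟪X, ∂ₜX + Σᵢ uᵢ ∂ᵢX⟫`
(`∂ₜ` the one-sided time derivative within `Ico 0 T`). [folklore] -/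
theorem torus_transport_energy_identity_norm_sq :
    ∀ {T : ℝ} {E : Type} [NormedAddCommGroup E] [InnerProductSpace ℝ E] {w : ℝ → T3 → ℝ}
      {X : ℝ → T3 → E} {u : ℝ → T3 → V3},
      Torus.IsSmoothSpaceTimeOn (Ico 0 T) w → Torus.IsSmoothSpaceTimeOn (Ico 0 T) X →
      Torus.IsSmoothSpaceTimeOn (Ico 0 T) u → ∀ {t : ℝ}, t ∈ Ico 0 T → ∀ x : T3,
        Torus.timeDerivWithin (Ico 0 T) (fun s y => w s y * ‖X s y‖ ^ 2) t x +
            ∑ i, Torus.partialDeriv i (fun y => w t y * ‖X t y‖ ^ 2 * u t y i) x =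
          (Torus.timeDerivWithin (Ico 0 T) w t x + ∑ i, u t x i * Torus.partialDeriv i (w t) x +
                w t x * ∑ i, Torus.partialDeriv i (fun y => u t y i) x) * ‖X t x‖ ^ 2 +
            2 * w t x * inner ℝ (X t x) (Torus.timeDerivWithin (Ico 0 T) X t x +
              ∑ i, u t x i • Torus.partialDeriv i (X t) x) := by
  intro T E _ _ w X u hw hX hu t ht x
  have hU : UniqueDiffOn ℝ (Ico (0 : ℝ) T) := uniqueDiffOn_Ico 0 T
  have hw1 : Torus.IsContDiff 1 (w t) := (hw.isSmooth_slice ht).isContDiff (by simp)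
  have hX1 : Torus.IsContDiff 1 (X t) := (hX.isSmooth_slice ht).isContDiff (by simp)
  have hu1 : Torus.IsContDiff 1 (u t) := (hu.isSmooth_slice ht).isContDiff (by simp)
  have huj1 : ∀ i, Torus.IsContDiff 1 (fun y => u t y i) := fun i => isContDiff_apply_coord hu1 i
  -- the vector field `X t` along coordinate lines (vector-valued `hasDerivAt_coordLine`)
  have cX : ∀ i : Fin 3, HasDerivAt
      (fun s : ℝ => X t (x + Torus.proj (s • EuclideanSpace.single i (1 : ℝ))))
      (Torus.partialDeriv i (X t) x) 0 := fun i => by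
    have h := Torus.hasDerivAt_comp_add_proj_smul hX1 x (EuclideanSpace.single i (1 : ℝ)) 0
    simp only [zero_smul, Torus.proj_zero, add_zero] at h
    exact h
  -- (1) the one-sided time derivative of `w ‖X‖²`
  rw [timeDerivWithin_eq_of_hasDerivWithinAt ((hw.hasDerivWithinAt_slice ht x).fun_mul
    (hX.hasDerivWithinAt_slice ht x).norm_sq) (hU t ht)]
  -- (2) the divergence of the flux `w ‖X‖² uᵢ`, coordinate by coordinate
  have hΦ : ∀ i, Torus.partialDeriv i (fun y => w t y * ‖X t y‖ ^ 2 * u t y i) x =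
      (Torus.partialDeriv i (w t) x * ‖X t x‖ ^ 2 +
          w t x * (2 * ⟪X t x, Torus.partialDeriv i (X t) x⟫_ℝ)) * u t x i +
        w t x * ‖X t x‖ ^ 2 * Torus.partialDeriv i (fun y => u t y i) x := by
    intro i
    exact partialDeriv_eq_of_hasDerivAt ((((hasDerivAt_coordLine hw1 x i).fun_mul
      (cX i).norm_sq).fun_mul (hasDerivAt_coordLine (huj1 i) x i)).congr_deriv
      (by simp only [zero_smul, Torus.proj_zero, add_zero]))
  simp only [hΦ, Fin.sum_univ_three, inner_add_right, inner_smul_right]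
  ring

end HsEulerCalc

namespace HsEulerStability

section WeightTransport

/-! ### Gradients of the pressure coefficients -/

/-- `∂ᵢ(a ζ(a)) = (ζ(a) + a ζ'(a)) ∂ᵢa` along a `C¹` torus function `a`, at a point where `a` takes
values in an open set on which `ζ` is smooth. [folklore] -/
theorem partialDeriv_self_mul_comp {a : T3 → ℝ} (ha : Torus.IsContDiff 1 a) {ζ : ℝ → ℝ}
    {J : Set ℝ} (hJ : IsOpen J) (hζ : ContDiffOn ℝ ∞ ζ J) (x : T3) (hx : a x ∈ J) (i : Fin 3) :
    Torus.partialDeriv i (fun y => a y * ζ (a y)) x =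
      (ζ (a x) + a x * deriv ζ (a x)) * Torus.partialDeriv i a x :=
  partialDeriv_eq_of_hasDerivAt (((hasDerivAt_coordLine ha x i).fun_mul
    (hasDerivAt_coordLine_comp ha hJ hζ x hx i)).congr_deriv
    (by simp only [zero_smul, Torus.proj_zero, add_zero]; ring))

/-- `∂ᵢ(b γ(a)) = ∂ᵢb γ(a) + b γ'(a) ∂ᵢa` with `γ = ζ + id·ζ'`, `γ' = 2ζ' + id·ζ''`, along `C¹`
torus functions `a, b`, at a point where `a` takes values in an open set on which `ζ` is
smooth. [folklore] -/
theorem partialDeriv_mul_gamma_comp {a b : T3 → ℝ} (ha : Torus.IsContDiff 1 a)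
    (hb : Torus.IsContDiff 1 b) {ζ : ℝ → ℝ} {J : Set ℝ} (hJ : IsOpen J) (hζ : ContDiffOn ℝ ∞ ζ J)
    (x : T3) (hx : a x ∈ J) (i : Fin 3) :
    Torus.partialDeriv i (fun y => b y * (ζ (a y) + a y * deriv ζ (a y))) x =
      Torus.partialDeriv i b x * (ζ (a x) + a x * deriv ζ (a x)) +
        b x * (2 * deriv ζ (a x) + a x * deriv (deriv ζ) (a x)) * Torus.partialDeriv i a x :=
  partialDeriv_eq_of_hasDerivAt (((hasDerivAt_coordLine hb x i).fun_mul
    ((hasDerivAt_coordLine_comp ha hJ hζ x hx i).fun_add ((hasDerivAt_coordLine ha x i).fun_mul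
      (hasDerivAt_coordLine_comp ha hJ (hζ.deriv_of_isOpen (m := ∞) hJ le_rfl) x hx
        i)))).congr_deriv
    (by simp only [zero_smul, Torus.proj_zero, add_zero]; ring))

/-- **Gradient of the density coefficient `θ γ(ρ) = ∂_ρ p`** along a classical hard-sphere–Euler
solution with density valued in an open set on which `ζ` is smooth:
`∂ᵢ(θ (ζ(ρ) + ρ ζ'(ρ))) = ∂ᵢθ (ζ(ρ) + ρ ζ'(ρ)) + θ (2ζ'(ρ) + ρ ζ''(ρ)) ∂ᵢρ` pointwise on
`[0, T) × 𝕋³`. [folklore] -/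
theorem hsEuler_coeffRho_partialDeriv :
    ∀ {σ T : ℝ} {ρ θ : ℝ → T3 → ℝ} {u : ℝ → T3 → V3} {ζ : ℝ → ℝ} {J : Set ℝ},
      IsHardSphereEulerSolution σ T ρ u θ → IsOpen J → ContDiffOn ℝ (⊤ : ℕ∞) ζ J →
      (∀ t ∈ Ico 0 T, ∀ x, ρ t x ∈ J) → ∀ {t : ℝ}, t ∈ Ico 0 T → ∀ x : T3, ∀ i : Fin 3,
        Torus.partialDeriv i (fun y => θ t y * (ζ (ρ t y) + ρ t y * deriv ζ (ρ t y))) x =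
          Torus.partialDeriv i (θ t) x * (ζ (ρ t x) + ρ t x * deriv ζ (ρ t x)) +
            θ t x * (2 * deriv ζ (ρ t x) + ρ t x * deriv (deriv ζ) (ρ t x)) *
              Torus.partialDeriv i (ρ t) x := by
  intro σ T ρ θ u ζ J hE hJ hζ hρJ t ht x i
  exact partialDeriv_mul_gamma_comp ((hE.smooth_density.isSmooth_slice ht).isContDiff (by simp))
    ((hE.smooth_temperature.isSmooth_slice ht).isContDiff (by simp)) hJ hζ x (hρJ t ht x) i

/-- **Gradient of the temperature coefficient `ρ ζ(ρ) = ∂_θ p`** along a classical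
hard-sphere–Euler solution with density valued in an open set on which `ζ` is smooth:
`∂ᵢ(ρ ζ(ρ)) = (ζ(ρ) + ρ ζ'(ρ)) ∂ᵢρ` pointwise on `[0, T) × 𝕋³`. [folklore] -/
theorem hsEuler_coeffTheta_partialDeriv :
    ∀ {σ T : ℝ} {ρ θ : ℝ → T3 → ℝ} {u : ℝ → T3 → V3} {ζ : ℝ → ℝ} {J : Set ℝ},
      IsHardSphereEulerSolution σ T ρ u θ → IsOpen J → ContDiffOn ℝ (⊤ : ℕ∞) ζ J →
      (∀ t ∈ Ico 0 T, ∀ x, ρ t x ∈ J) → ∀ {t : ℝ}, t ∈ Ico 0 T → ∀ x : T3, ∀ i : Fin 3,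
        Torus.partialDeriv i (fun y => ρ t y * ζ (ρ t y)) x =
          (ζ (ρ t x) + ρ t x * deriv ζ (ρ t x)) * Torus.partialDeriv i (ρ t) x := by
  intro σ T ρ θ u ζ J hE hJ hζ hρJ t ht x i
  exact partialDeriv_self_mul_comp ((hE.smooth_density.isSmooth_slice ht).isContDiff (by simp))
    hJ hζ x (hρJ t ht x) i

/-! ### Transport of the weights -/

/-- **Transport of the weight `B = 3ρ/(2θ)`** along a classical hard-sphere–Euler solution with
pressure `ρ θ ζ(ρ)`: `∂ₜB + u·∇B + B div u = (2/3) ζ(ρ) B div u` pointwise on `[0, T) × 𝕋³`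
(from `D_t ρ = -ρ div u` and `D_t θ = -(2/3) θ ζ(ρ) div u`: `D_t B = B (-1 + (2/3) ζ(ρ)) div u`).
[folklore] -/
theorem hsEuler_weightB_transport :
    ∀ {σ T : ℝ} {ρ θ : ℝ → T3 → ℝ} {u : ℝ → T3 → V3} {ζ : ℝ → ℝ} {J : Set ℝ},
      IsHardSphereEulerSolution σ T ρ u θ → IsOpen J → ContDiffOn ℝ (⊤ : ℕ∞) ζ J →
      (∀ t ∈ Ico 0 T, ∀ x, ρ t x ∈ J) →
      (∀ t ∈ Ico 0 T, ∀ x, hsPressure σ (ρ t x) (θ t x) = ρ t x * θ t x * ζ (ρ t x)) →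
      ∀ {t : ℝ}, t ∈ Ico 0 T → ∀ x : T3,
        Torus.timeDerivWithin (Ico 0 T) (fun s y => 3 / 2 * ρ s y / θ s y) t x +
              ∑ i, u t x i * Torus.partialDeriv i (fun y => 3 / 2 * ρ t y / θ t y) x +
            3 / 2 * ρ t x / θ t x * ∑ i, Torus.partialDeriv i (fun y => u t y i) x =
          2 / 3 * ζ (ρ t x) * (3 / 2 * ρ t x / θ t x) *
            ∑ i, Torus.partialDeriv i (fun y => u t y i) x := by
  intro σ T ρ θ u ζ J hE hJ hζ hρJ hp t ht x
  have hU : UniqueDiffOn ℝ (Ico (0 : ℝ) T) := uniqueDiffOn_Ico 0 T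
  have hρ1 : Torus.IsContDiff 1 (ρ t) := (hE.smooth_density.isSmooth_slice ht).isContDiff (by simp)
  have hθ1 : Torus.IsContDiff 1 (θ t) :=
    (hE.smooth_temperature.isSmooth_slice ht).isContDiff (by simp)
  have hθ0 : θ t x ≠ 0 := (hE.temperature_pos t ht x).ne'
  have hθ0' : ∀ i : Fin 3,
      θ t (x + Torus.proj ((0 : ℝ) • EuclideanSpace.single i (1 : ℝ))) ≠ 0 := by
    intro i; simpa using hθ0
  -- the time derivative of `B` (quotient rule along the time slice)
  rw [timeDerivWithin_eq_of_hasDerivWithinAt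
    (((hE.smooth_density.hasDerivWithinAt_slice ht x).const_mul (3 / 2)).fun_div
      (hE.smooth_temperature.hasDerivWithinAt_slice ht x) hθ0) (hU t ht)]
  -- the gradient of `B` (quotient rule along coordinate lines)
  have hB : ∀ i, Torus.partialDeriv i (fun y => 3 / 2 * ρ t y / θ t y) x =
      3 / 2 * (Torus.partialDeriv i (ρ t) x * θ t x - ρ t x * Torus.partialDeriv i (θ t) x) /
        θ t x ^ 2 := by
    intro i
    exact partialDeriv_eq_of_hasDerivAt ((((hasDerivAt_coordLine hρ1 x i).const_mul
      (3 / 2)).fun_div (hasDerivAt_coordLine hθ1 x i) (hθ0' i)).congr_deriv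
      (by simp only [zero_smul, Torus.proj_zero, add_zero]; ring))
  simp only [hB]
  -- substitute the primitive equations and close by algebra
  have hP1 := hE.timeDeriv_density_eq ht x
  have hP3 := hE.timeDeriv_temperature_eq hJ hζ hρJ hp ht x
  simp only [Fin.sum_univ_three] at hP1 hP3 ⊢
  rw [hP1, hP3]
  field_simp
  ring

/-- **Transport of the weight `A = θ γ(ρ)/ρ`** (`γ = ζ + id·ζ'`) along a classical
hard-sphere–Euler solution with pressure `ρ θ ζ(ρ)`:
`∂ₜA + u·∇A + A div u = (A (2 - (2/3) ζ(ρ)) - θ (2 ζ'(ρ) + ρ ζ''(ρ))) div u` pointwise on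
`[0, T) × 𝕋³` (from `D_t ρ = -ρ div u`, `D_t θ = -(2/3) θ ζ(ρ) div u` and the chain rule
`D_t γ(ρ) = γ'(ρ) D_t ρ`: `D_t A = (A - (2/3) ζ(ρ) A - θ γ'(ρ)) div u`; for the ideal gas `ζ ≡ 1`
this is `(4/3) A div u`). [folklore] -/
theorem hsEuler_weightA_transport :
    ∀ {σ T : ℝ} {ρ θ : ℝ → T3 → ℝ} {u : ℝ → T3 → V3} {ζ : ℝ → ℝ} {J : Set ℝ},
      IsHardSphereEulerSolution σ T ρ u θ → IsOpen J → ContDiffOn ℝ (⊤ : ℕ∞) ζ J →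
      (∀ t ∈ Ico 0 T, ∀ x, ρ t x ∈ J) →
      (∀ t ∈ Ico 0 T, ∀ x, hsPressure σ (ρ t x) (θ t x) = ρ t x * θ t x * ζ (ρ t x)) →
      ∀ {t : ℝ}, t ∈ Ico 0 T → ∀ x : T3,
        Torus.timeDerivWithin (Ico 0 T)
                (fun s y => θ s y * (ζ (ρ s y) + ρ s y * deriv ζ (ρ s y)) / ρ s y) t x +
              ∑ i, u t x i * Torus.partialDeriv i
                (fun y => θ t y * (ζ (ρ t y) + ρ t y * deriv ζ (ρ t y)) / ρ t y) x +
            θ t x * (ζ (ρ t x) + ρ t x * deriv ζ (ρ t x)) / ρ t x *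
              ∑ i, Torus.partialDeriv i (fun y => u t y i) x =
          (θ t x * (ζ (ρ t x) + ρ t x * deriv ζ (ρ t x)) / ρ t x * (2 - 2 / 3 * ζ (ρ t x)) -
              θ t x * (2 * deriv ζ (ρ t x) + ρ t x * deriv (deriv ζ) (ρ t x))) *
            ∑ i, Torus.partialDeriv i (fun y => u t y i) x := by
  intro σ T ρ θ u ζ J hE hJ hζ hρJ hp t ht x
  have hU : UniqueDiffOn ℝ (Ico (0 : ℝ) T) := uniqueDiffOn_Ico 0 T
  have hρ1 : Torus.IsContDiff 1 (ρ t) := (hE.smooth_density.isSmooth_slice ht).isContDiff (by simp)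
  have hθ1 : Torus.IsContDiff 1 (θ t) :=
    (hE.smooth_temperature.isSmooth_slice ht).isContDiff (by simp)
  have hζ' : ContDiffOn ℝ ∞ (deriv ζ) J := hζ.deriv_of_isOpen (m := ∞) hJ le_rfl
  have hρ0 : ρ t x ≠ 0 := (hE.density_pos t ht x).ne'
  have hxJ : ρ t x ∈ J := hρJ t ht x
  -- chain rules along the time slice: `∂ₜ ζ(ρ) = ζ'(ρ) ∂ₜρ`, `∂ₜ ζ'(ρ) = ζ''(ρ) ∂ₜρ`
  have hd1 : HasDerivAt ζ (deriv ζ (ρ t x)) (ρ t x) :=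
    ((hζ.differentiableOn (by simp)).differentiableAt (hJ.mem_nhds hxJ)).hasDerivAt
  have hd2 : HasDerivAt (deriv ζ) (deriv (deriv ζ) (ρ t x)) (ρ t x) :=
    ((hζ'.differentiableOn (by simp)).differentiableAt (hJ.mem_nhds hxJ)).hasDerivAt
  have sρ := hE.smooth_density.hasDerivWithinAt_slice ht x
  have sθ := hE.smooth_temperature.hasDerivWithinAt_slice ht x
  have sζ : HasDerivWithinAt (fun τ => ζ (ρ τ x))
      (deriv ζ (ρ t x) * Torus.timeDerivWithin (Ico 0 T) ρ t x) (Ico 0 T) t := by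
    have h := hd1.comp_hasDerivWithinAt t sρ
    exact h
  have sζd : HasDerivWithinAt (fun τ => deriv ζ (ρ τ x))
      (deriv (deriv ζ) (ρ t x) * Torus.timeDerivWithin (Ico 0 T) ρ t x) (Ico 0 T) t := by
    have h := hd2.comp_hasDerivWithinAt t sρ
    exact h
  -- the time derivative of `A` (product and quotient rules along the time slice)
  rw [timeDerivWithin_eq_of_hasDerivWithinAt
    ((sθ.fun_mul (sζ.fun_add (sρ.fun_mul sζd))).fun_div sρ hρ0) (hU t ht)]
  -- the gradient of `A` (chain, product and quotient rules along coordinate lines)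
  have hρ0' : ∀ i : Fin 3,
      ρ t (x + Torus.proj ((0 : ℝ) • EuclideanSpace.single i (1 : ℝ))) ≠ 0 := by
    intro i; simpa using hρ0
  have hA : ∀ i, Torus.partialDeriv i
      (fun y => θ t y * (ζ (ρ t y) + ρ t y * deriv ζ (ρ t y)) / ρ t y) x =
      (Torus.partialDeriv i (θ t) x * (ζ (ρ t x) + ρ t x * deriv ζ (ρ t x)) * ρ t x +
          θ t x * (2 * deriv ζ (ρ t x) + ρ t x * deriv (deriv ζ) (ρ t x)) *
            Torus.partialDeriv i (ρ t) x * ρ t x -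
          θ t x * (ζ (ρ t x) + ρ t x * deriv ζ (ρ t x)) * Torus.partialDeriv i (ρ t) x) /
        ρ t x ^ 2 := by
    intro i
    exact partialDeriv_eq_of_hasDerivAt ((((hasDerivAt_coordLine hθ1 x i).fun_mul
      ((hasDerivAt_coordLine_comp hρ1 hJ hζ x hxJ i).fun_add ((hasDerivAt_coordLine hρ1 x i).fun_mul
        (hasDerivAt_coordLine_comp hρ1 hJ hζ' x hxJ i)))).fun_div (hasDerivAt_coordLine hρ1 x i)
      (hρ0' i)).congr_deriv (by simp only [zero_smul, Torus.proj_zero, add_zero]; ring))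
  simp only [hA]
  -- substitute the primitive equations and close by algebra
  have hP1 := hE.timeDeriv_density_eq ht x
  have hP3 := hE.timeDeriv_temperature_eq hJ hζ hρJ hp ht x
  simp only [Fin.sum_univ_three] at hP1 hP3 ⊢
  rw [hP1, hP3]
  field_simp
  ring

end WeightTransport

section Frozen

/-- **Symmetrised energy identity for the frozen-coefficient linearised hard-sphere Euler
operator, pointwise.** For a classical hard-sphere–Euler solution `(ρ, u, θ)` on `[0, T) × 𝕋³`,
ANY function `ζ` smooth on an open set `J` containing the values of `ρ` (weights
`A = θ (ζ(ρ) + ρ ζ'(ρ))/ρ`, `B = 3ρ/(2θ)`; in the application `ρ θ ζ(ρ)` is the pressure, which is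
not needed for the identity) and ARBITRARY jointly smooth fields `α, β` (scalar) and `w` (vector)
on `[0, T) × 𝕋³`, the energy density `e = ½ (A α² + ρ |w|² + B β²)` and the fluxes
`Φᵢ = ½ (A uᵢ α² + ρ uᵢ |w|² + B uᵢ β²) + θ (ζ(ρ) + ρ ζ'(ρ)) α wᵢ + ρ ζ(ρ) β wᵢ` satisfy
`∂ₜe + Σᵢ ∂ᵢΦᵢ = Q + A α F_ρ + ρ Σⱼ wⱼ F_uⱼ + B β F_θ`, where (right-hand side, in this order)
`Q = ½ (∂ₜA + u·∇A + A div u) α² + ½ (∂ₜB + u·∇B + B div u) β² + Σᵢ ∂ᵢ(θ (ζ(ρ) + ρ ζ'(ρ))) α wᵢ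
 + Σᵢ ∂ᵢ(ρ ζ(ρ)) β wᵢ` and `F_ρ = ∂ₜα + u·∇α + ρ div w`, `F_uⱼ = ∂ₜwⱼ + u·∇wⱼ + A ∂ⱼα + ζ(ρ) ∂ⱼβ`,
`F_θ = ∂ₜβ + u·∇β + (2/3) θ ζ(ρ) div w` is the frozen-coefficient linearised operator applied to
`(α, w, β)`. [folklore] -/
theorem hsEuler_frozen_energy_identity :
    ∀ {σ T : ℝ} {ρ θ : ℝ → T3 → ℝ} {u : ℝ → T3 → V3} {ζ : ℝ → ℝ} {J : Set ℝ}
      {α β : ℝ → T3 → ℝ} {w : ℝ → T3 → V3},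
    IsHardSphereEulerSolution σ T ρ u θ → IsOpen J → ContDiffOn ℝ (⊤ : ℕ∞) ζ J →
    (∀ t ∈ Ico 0 T, ∀ x, ρ t x ∈ J) →
    Torus.IsSmoothSpaceTimeOn (Ico 0 T) α → Torus.IsSmoothSpaceTimeOn (Ico 0 T) w →
    Torus.IsSmoothSpaceTimeOn (Ico 0 T) β →
    ∀ {t : ℝ}, t ∈ Ico 0 T → ∀ x : T3,
    Torus.timeDerivWithin (Ico 0 T) (fun s y => 1 / 2 *
        (θ s y * (ζ (ρ s y) + ρ s y * deriv ζ (ρ s y)) / ρ s y * α s y ^ 2 +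
          ρ s y * ‖w s y‖ ^ 2 + 3 / 2 * ρ s y / θ s y * β s y ^ 2)) t x +
      ∑ i, Torus.partialDeriv i (fun y =>
        1 / 2 * (θ t y * (ζ (ρ t y) + ρ t y * deriv ζ (ρ t y)) / ρ t y * u t y i * α t y ^ 2 +
            ρ t y * u t y i * ‖w t y‖ ^ 2 +
            3 / 2 * ρ t y / θ t y * u t y i * β t y ^ 2) +
          θ t y * (ζ (ρ t y) + ρ t y * deriv ζ (ρ t y)) * α t y * w t y i +
          ρ t y * ζ (ρ t y) * β t y * w t y i) x =
      1 / 2 * (Torus.timeDerivWithin (Ico 0 T)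
            (fun s y => θ s y * (ζ (ρ s y) + ρ s y * deriv ζ (ρ s y)) / ρ s y) t x +
          ∑ i, u t x i * Torus.partialDeriv i
            (fun y => θ t y * (ζ (ρ t y) + ρ t y * deriv ζ (ρ t y)) / ρ t y) x +
          θ t x * (ζ (ρ t x) + ρ t x * deriv ζ (ρ t x)) / ρ t x *
            ∑ i, Torus.partialDeriv i (fun y => u t y i) x) * α t x ^ 2 +
      1 / 2 * (Torus.timeDerivWithin (Ico 0 T) (fun s y => 3 / 2 * ρ s y / θ s y) t x +
          ∑ i, u t x i * Torus.partialDeriv i (fun y => 3 / 2 * ρ t y / θ t y) x +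
          3 / 2 * ρ t x / θ t x * ∑ i, Torus.partialDeriv i (fun y => u t y i) x) * β t x ^ 2 +
      ∑ i, Torus.partialDeriv i (fun y => θ t y * (ζ (ρ t y) + ρ t y * deriv ζ (ρ t y))) x *
          α t x * w t x i +
      ∑ i, Torus.partialDeriv i (fun y => ρ t y * ζ (ρ t y)) x * β t x * w t x i +
      θ t x * (ζ (ρ t x) + ρ t x * deriv ζ (ρ t x)) / ρ t x * α t x *
        (Torus.timeDerivWithin (Ico 0 T) α t x + ∑ i, u t x i * Torus.partialDeriv i (α t) x +
          ρ t x * ∑ i, Torus.partialDeriv i (fun y => w t y i) x) +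
      ρ t x * ∑ j, w t x j *
        (Torus.timeDerivWithin (Ico 0 T) (fun s y => w s y j) t x +
          ∑ i, u t x i * Torus.partialDeriv i (fun y => w t y j) x +
          θ t x * (ζ (ρ t x) + ρ t x * deriv ζ (ρ t x)) / ρ t x * Torus.partialDeriv j (α t) x +
          ζ (ρ t x) * Torus.partialDeriv j (β t) x) +
      3 / 2 * ρ t x / θ t x * β t x *
        (Torus.timeDerivWithin (Ico 0 T) β t x + ∑ i, u t x i * Torus.partialDeriv i (β t) x +
          2 / 3 * (θ t x * ζ (ρ t x)) * ∑ i, Torus.partialDeriv i (fun y => w t y i) x) := by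
  -- adapted from `IsHardSphereEulerSolution.relativeEnergy_balance` (PrimitiveForm): one solution, free `W`
  intro σ T ρ θ u ζ J α β w hE hJ hζ hρJ hα hw hβ t ht x
  have hU : UniqueDiffOn ℝ (Ico (0 : ℝ) T) := uniqueDiffOn_Ico 0 T
  -- smooth slices of the solution, of the free fields, of the weights and coefficients
  have hρ1 : Torus.IsContDiff 1 (ρ t) := (hE.smooth_density.isSmooth_slice ht).isContDiff (by simp)
  have hθ1 : Torus.IsContDiff 1 (θ t) :=
    (hE.smooth_temperature.isSmooth_slice ht).isContDiff (by simp)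
  have hu1 : Torus.IsContDiff 1 (u t) := (hE.smooth_velocity.isSmooth_slice ht).isContDiff (by simp)
  have huj1 : ∀ i, Torus.IsContDiff 1 (fun y => u t y i) := fun i => isContDiff_apply_coord hu1 i
  have hα1 : Torus.IsContDiff 1 (α t) := (hα.isSmooth_slice ht).isContDiff (by simp)
  have hβ1 : Torus.IsContDiff 1 (β t) := (hβ.isSmooth_slice ht).isContDiff (by simp)
  have hw1 : Torus.IsContDiff 1 (w t) := (hw.isSmooth_slice ht).isContDiff (by simp)
  have hwj1 : ∀ i, Torus.IsContDiff 1 (fun y => w t y i) := fun i => isContDiff_apply_coord hw1 i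
  have hζ1 : Torus.IsContDiff 1 (fun y => ζ (ρ t y)) :=
    (hζ.of_le (by simp)).comp_contDiff hρ1 fun v => hρJ t ht _
  have hζd1 : Torus.IsContDiff 1 (fun y => deriv ζ (ρ t y)) :=
    ((hζ.deriv_of_isOpen (m := ∞) hJ le_rfl).of_le (by simp)).comp_contDiff hρ1 fun v => hρJ t ht _
  have hAf := hE.isSmoothSpaceTimeOn_weightA hJ hζ hρJ
  have hBf := hE.isSmoothSpaceTimeOn_weightB
  have hA1 : Torus.IsContDiff 1
      (fun y => θ t y * (ζ (ρ t y) + ρ t y * deriv ζ (ρ t y)) / ρ t y) :=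
    (hAf.isSmooth_slice ht).isContDiff (by simp)
  have hB1 : Torus.IsContDiff 1 (fun y => 3 / 2 * ρ t y / θ t y) :=
    (hBf.isSmooth_slice ht).isContDiff (by simp)
  have hpr1 : Torus.IsContDiff 1 (fun y => θ t y * (ζ (ρ t y) + ρ t y * deriv ζ (ρ t y))) :=
    (ContDiff.mul hθ1 (ContDiff.add hζ1 (ContDiff.mul hρ1 hζd1)) :)
  have hph1 : Torus.IsContDiff 1 (fun y => ρ t y * ζ (ρ t y)) := (hρ1.mul hζ1 :)
  -- coordinate-line derivatives at `x`
  have cρ := fun i => hasDerivAt_coordLine hρ1 x i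
  have cu := fun i k => hasDerivAt_coordLine (huj1 k) x i
  have cα := fun i => hasDerivAt_coordLine hα1 x i
  have cβ := fun i => hasDerivAt_coordLine hβ1 x i
  have cw := fun i k => hasDerivAt_coordLine (hwj1 k) x i
  have cA := fun i => hasDerivAt_coordLine hA1 x i
  have cB := fun i => hasDerivAt_coordLine hB1 x i
  have cpr := fun i => hasDerivAt_coordLine hpr1 x i
  have cph := fun i => hasDerivAt_coordLine hph1 x i
  -- time-slice derivatives at `x`
  have sρ := hE.smooth_density.hasDerivWithinAt_slice ht x
  have sα := hα.hasDerivWithinAt_slice ht x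
  have sβ := hβ.hasDerivWithinAt_slice ht x
  have sw := fun k => (hw.apply k).hasDerivWithinAt_slice ht x
  have sA := hAf.hasDerivWithinAt_slice ht x
  have sB := hBf.hasDerivWithinAt_slice ht x
  -- `|w|²` in coordinates
  have hnorm : ∀ s y, ‖w s y‖ ^ 2 = (w s y 0) ^ 2 + (w s y 1) ^ 2 + (w s y 2) ^ 2 := by
    intro s y
    simp only [EuclideanSpace.norm_sq_eq, Fin.sum_univ_three, Real.norm_eq_abs, sq_abs]
  simp only [hnorm]
  -- (1) the time derivative of the energy density
  rw [timeDerivWithin_eq_of_hasDerivWithinAt ((((sA.fun_mul (sα.fun_pow 2)).fun_add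
    (sρ.fun_mul ((((sw 0).fun_pow 2).fun_add ((sw 1).fun_pow 2)).fun_add
      ((sw 2).fun_pow 2)))).fun_add (sB.fun_mul (sβ.fun_pow 2))).const_mul (1 / 2)) (hU t ht)]
  -- (2) the divergence of the flux, coordinate by coordinate
  have hΦ : ∀ i, Torus.partialDeriv i (fun y =>
      1 / 2 * (θ t y * (ζ (ρ t y) + ρ t y * deriv ζ (ρ t y)) / ρ t y * u t y i * α t y ^ 2 +
          ρ t y * u t y i * ((w t y 0) ^ 2 + (w t y 1) ^ 2 + (w t y 2) ^ 2) +
          3 / 2 * ρ t y / θ t y * u t y i * β t y ^ 2) +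
        θ t y * (ζ (ρ t y) + ρ t y * deriv ζ (ρ t y)) * α t y * w t y i +
        ρ t y * ζ (ρ t y) * β t y * w t y i) x =
      1 / 2 * ((Torus.partialDeriv i
                (fun y => θ t y * (ζ (ρ t y) + ρ t y * deriv ζ (ρ t y)) / ρ t y) x * u t x i +
              θ t x * (ζ (ρ t x) + ρ t x * deriv ζ (ρ t x)) / ρ t x *
                Torus.partialDeriv i (fun y => u t y i) x) * α t x ^ 2 +
          θ t x * (ζ (ρ t x) + ρ t x * deriv ζ (ρ t x)) / ρ t x * u t x i *
            (2 * α t x * Torus.partialDeriv i (α t) x) +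
          ((Torus.partialDeriv i (ρ t) x * u t x i +
              ρ t x * Torus.partialDeriv i (fun y => u t y i) x) *
            ((w t x 0) ^ 2 + (w t x 1) ^ 2 + (w t x 2) ^ 2) +
          ρ t x * u t x i * (2 * w t x 0 * Torus.partialDeriv i (fun y => w t y 0) x +
            2 * w t x 1 * Torus.partialDeriv i (fun y => w t y 1) x +
            2 * w t x 2 * Torus.partialDeriv i (fun y => w t y 2) x)) +
          ((Torus.partialDeriv i (fun y => 3 / 2 * ρ t y / θ t y) x * u t x i +
              3 / 2 * ρ t x / θ t x * Torus.partialDeriv i (fun y => u t y i) x) * β t x ^ 2 +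
            3 / 2 * ρ t x / θ t x * u t x i * (2 * β t x * Torus.partialDeriv i (β t) x))) +
        (Torus.partialDeriv i (fun y => θ t y * (ζ (ρ t y) + ρ t y * deriv ζ (ρ t y))) x *
            α t x * w t x i +
          θ t x * (ζ (ρ t x) + ρ t x * deriv ζ (ρ t x)) *
            (Torus.partialDeriv i (α t) x * w t x i +
              α t x * Torus.partialDeriv i (fun y => w t y i) x)) +
        (Torus.partialDeriv i (fun y => ρ t y * ζ (ρ t y)) x * β t x * w t x i +
          ρ t x * ζ (ρ t x) *
            (Torus.partialDeriv i (β t) x * w t x i +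
              β t x * Torus.partialDeriv i (fun y => w t y i) x)) := by
    intro i
    exact partialDeriv_eq_of_hasDerivAt (((((((cA i).fun_mul (cu i i)).fun_mul
      ((cα i).fun_pow 2)).fun_add (((cρ i).fun_mul (cu i i)).fun_mul (((((cw i 0).fun_pow 2).fun_add
        ((cw i 1).fun_pow 2)).fun_add ((cw i 2).fun_pow 2))))).fun_add
      (((cB i).fun_mul (cu i i)).fun_mul ((cβ i).fun_pow 2))).const_mul (1 / 2) |>.fun_add
      (((cpr i).fun_mul (cα i)).fun_mul (cw i i)) |>.fun_add
      (((cph i).fun_mul (cβ i)).fun_mul (cw i i))).congr_deriv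
      (by simp only [zero_smul, Torus.proj_zero, add_zero]; ring))
  simp only [hΦ]
  -- (3) the mass equation and the symmetriser relations
  have hP1 := hE.timeDeriv_density_eq ht x
  have hρ0 : ρ t x ≠ 0 := (hE.density_pos t ht x).ne'
  have hθ0 : θ t x ≠ 0 := (hE.temperature_pos t ht x).ne'
  have hA : θ t x * (ζ (ρ t x) + ρ t x * deriv ζ (ρ t x)) / ρ t x * ρ t x =
      θ t x * (ζ (ρ t x) + ρ t x * deriv ζ (ρ t x)) := div_mul_cancel₀ _ hρ0
  have hB : 2 * (3 / 2 * ρ t x / θ t x) * θ t x = 3 * ρ t x := by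
    field_simp
  simp only [Fin.sum_univ_three] at hP1
  repeat rw [Fin.sum_univ_three]
  linear_combination
    1 / 2 * ((w t x 0) ^ 2 + (w t x 1) ^ 2 + (w t x 2) ^ 2) * hP1 -
    (α t x * (Torus.partialDeriv 0 (fun y => w t y 0) x + Torus.partialDeriv 1 (fun y => w t y 1) x +
        Torus.partialDeriv 2 (fun y => w t y 2) x) +
      (w t x 0 * Torus.partialDeriv 0 (α t) x + w t x 1 * Torus.partialDeriv 1 (α t) x +
        w t x 2 * Torus.partialDeriv 2 (α t) x)) * hA -
    1 / 3 * ζ (ρ t x) * β t x * (Torus.partialDeriv 0 (fun y => w t y 0) x +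
      Torus.partialDeriv 1 (fun y => w t y 1) x + Torus.partialDeriv 2 (fun y => w t y 2) x) * hB

end Frozen

section Explicit

variable {σ T : ℝ} {ρ θ : ℝ → T3 → ℝ} {u : ℝ → T3 → V3} {ζ : ℝ → ℝ} {J : Set ℝ}
  {α β : ℝ → T3 → ℝ} {w : ℝ → T3 → V3}

/-- The energy density `e = ½ (A α² + ρ |w|² + B β²)` of the frozen-coefficient identity is
jointly smooth on `[0, T) × 𝕋³` for jointly smooth `α, w, β` (to differentiate `∫ e` in time).
[folklore] -/
theorem isSmoothSpaceTimeOn_frozenEnergy (hE : IsHardSphereEulerSolution σ T ρ u θ)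
    (hJ : IsOpen J) (hζ : ContDiffOn ℝ ∞ ζ J) (hρJ : ∀ t ∈ Ico 0 T, ∀ x, ρ t x ∈ J)
    (hα : Torus.IsSmoothSpaceTimeOn (Ico 0 T) α) (hw : Torus.IsSmoothSpaceTimeOn (Ico 0 T) w)
    (hβ : Torus.IsSmoothSpaceTimeOn (Ico 0 T) β) :
    Torus.IsSmoothSpaceTimeOn (Ico 0 T) (fun s y => 1 / 2 *
        (θ s y * (ζ (ρ s y) + ρ s y * deriv ζ (ρ s y)) / ρ s y * α s y ^ 2 +
          ρ s y * ‖w s y‖ ^ 2 + 3 / 2 * ρ s y / θ s y * β s y ^ 2)) := by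
  have hal2 : Torus.IsSmoothSpaceTimeOn (Ico 0 T) (fun t x => α t x ^ 2) := hα.pow 2
  have hbe2 : Torus.IsSmoothSpaceTimeOn (Ico 0 T) (fun t x => β t x ^ 2) := hβ.pow 2
  have hw2 : Torus.IsSmoothSpaceTimeOn (Ico 0 T) (fun t x => ‖w t x‖ ^ 2) := hw.norm_sq ℝ
  have hhalf : Torus.IsSmoothSpaceTimeOn (Ico 0 T) (fun (_ : ℝ) (_ : T3) => (1 / 2 : ℝ)) :=
    Torus.isSmoothSpaceTimeOn_const (Torus.isSmooth_const _) _
  exact hhalf.mul ((((hE.isSmoothSpaceTimeOn_weightA hJ hζ hρJ).mul hal2).add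
    (hE.smooth_density.mul hw2)).add ((hE.isSmoothSpaceTimeOn_weightB).mul hbe2))

/-- The fluxes `Φᵢ = ½ (A uᵢ α² + ρ uᵢ |w|² + B uᵢ β²) + θ γ(ρ) α wᵢ + ρ ζ(ρ) β wᵢ` of the
frozen-coefficient identity are jointly smooth on `[0, T) × 𝕋³` for jointly smooth `α, w, β`
(so that `∫ Σᵢ ∂ᵢΦᵢ = 0` on every time slice). [folklore] -/
theorem isSmoothSpaceTimeOn_frozenFlux (hE : IsHardSphereEulerSolution σ T ρ u θ)
    (hJ : IsOpen J) (hζ : ContDiffOn ℝ ∞ ζ J) (hρJ : ∀ t ∈ Ico 0 T, ∀ x, ρ t x ∈ J)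
    (hα : Torus.IsSmoothSpaceTimeOn (Ico 0 T) α) (hw : Torus.IsSmoothSpaceTimeOn (Ico 0 T) w)
    (hβ : Torus.IsSmoothSpaceTimeOn (Ico 0 T) β) (i : Fin 3) :
    Torus.IsSmoothSpaceTimeOn (Ico 0 T) (fun t y =>
      1 / 2 * (θ t y * (ζ (ρ t y) + ρ t y * deriv ζ (ρ t y)) / ρ t y * u t y i * α t y ^ 2 +
          ρ t y * u t y i * ‖w t y‖ ^ 2 +
          3 / 2 * ρ t y / θ t y * u t y i * β t y ^ 2) +
        θ t y * (ζ (ρ t y) + ρ t y * deriv ζ (ρ t y)) * α t y * w t y i +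
        ρ t y * ζ (ρ t y) * β t y * w t y i) := by
  have hρ := hE.smooth_density
  have hu := hE.smooth_velocity
  have hζρ := isSmoothSpaceTimeOn_comp_density hρ hζ hρJ
  have hζdρ := isSmoothSpaceTimeOn_comp_density hρ (hζ.deriv_of_isOpen (m := ∞) hJ le_rfl) hρJ
  have hγf : Torus.IsSmoothSpaceTimeOn (Ico 0 T)
      (fun s y => ζ (ρ s y) + ρ s y * deriv ζ (ρ s y)) := hζρ.add (hρ.mul hζdρ)
  have hal2 : Torus.IsSmoothSpaceTimeOn (Ico 0 T) (fun t x => α t x ^ 2) := hα.pow 2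
  have hbe2 : Torus.IsSmoothSpaceTimeOn (Ico 0 T) (fun t x => β t x ^ 2) := hβ.pow 2
  have hw2 : Torus.IsSmoothSpaceTimeOn (Ico 0 T) (fun t x => ‖w t x‖ ^ 2) := hw.norm_sq ℝ
  have hhalf : Torus.IsSmoothSpaceTimeOn (Ico 0 T) (fun (_ : ℝ) (_ : T3) => (1 / 2 : ℝ)) :=
    Torus.isSmoothSpaceTimeOn_const (Torus.isSmooth_const _) _
  exact ((hhalf.mul (((((hE.isSmoothSpaceTimeOn_weightA hJ hζ hρJ).mul (hu.apply i)).mul hal2).add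
    ((hρ.mul (hu.apply i)).mul hw2)).add (((hE.isSmoothSpaceTimeOn_weightB).mul (hu.apply i)).mul
      hbe2))).add (((hE.smooth_temperature.mul hγf).mul hα).mul (hw.apply i))).add
    (((hρ.mul hζρ).mul hβ).mul (hw.apply i))

/-- **The frozen-coefficient energy identity with zero-order coefficients.** The identity
`hsEuler_frozen_energy_identity` for a classical solution whose pressure IS `ρ θ ζ(ρ)`, with the
transport coefficients of the weights and the cross coefficients evaluated (`WeightTransport`:
`hsEuler_weightA_transport`, `hsEuler_weightB_transport`, `hsEuler_coeffRho_partialDeriv`,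
`hsEuler_coeffTheta_partialDeriv`): `∂ₜe + Σᵢ ∂ᵢΦᵢ = Q + A α F_ρ + ρ Σⱼ wⱼ F_uⱼ + B β F_θ` with
`Q = ½ (A (2 - (2/3) ζ) - θ (2ζ' + ρ ζ'')) (div u) α² + ½ ((2/3) ζ B) (div u) β²
 + Σᵢ (∂ᵢθ γ + θ (2ζ' + ρ ζ'') ∂ᵢρ) α wᵢ + Σᵢ γ ∂ᵢρ β wᵢ` (`ζ, ζ', ζ''` at `ρ`, `γ = ζ + ρ ζ'`):
every coefficient of the quadratic form is a zero-order quantity times `div u`, `∇θ` or `∇ρ`.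
[folklore] -/
theorem hsEuler_frozen_energy_identity_explicit (hE : IsHardSphereEulerSolution σ T ρ u θ)
    (hJ : IsOpen J) (hζ : ContDiffOn ℝ ∞ ζ J) (hρJ : ∀ t ∈ Ico 0 T, ∀ x, ρ t x ∈ J)
    (hp : ∀ t ∈ Ico 0 T, ∀ x, hsPressure σ (ρ t x) (θ t x) = ρ t x * θ t x * ζ (ρ t x))
    (hα : Torus.IsSmoothSpaceTimeOn (Ico 0 T) α) (hw : Torus.IsSmoothSpaceTimeOn (Ico 0 T) w)
    (hβ : Torus.IsSmoothSpaceTimeOn (Ico 0 T) β) {t : ℝ} (ht : t ∈ Ico 0 T) (x : T3) :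
    Torus.timeDerivWithin (Ico 0 T) (fun s y => 1 / 2 *
        (θ s y * (ζ (ρ s y) + ρ s y * deriv ζ (ρ s y)) / ρ s y * α s y ^ 2 +
          ρ s y * ‖w s y‖ ^ 2 + 3 / 2 * ρ s y / θ s y * β s y ^ 2)) t x +
      ∑ i, Torus.partialDeriv i (fun y =>
        1 / 2 * (θ t y * (ζ (ρ t y) + ρ t y * deriv ζ (ρ t y)) / ρ t y * u t y i * α t y ^ 2 +
            ρ t y * u t y i * ‖w t y‖ ^ 2 +
            3 / 2 * ρ t y / θ t y * u t y i * β t y ^ 2) +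
          θ t y * (ζ (ρ t y) + ρ t y * deriv ζ (ρ t y)) * α t y * w t y i +
          ρ t y * ζ (ρ t y) * β t y * w t y i) x =
      1 / 2 * ((θ t x * (ζ (ρ t x) + ρ t x * deriv ζ (ρ t x)) / ρ t x * (2 - 2 / 3 * ζ (ρ t x)) -
            θ t x * (2 * deriv ζ (ρ t x) + ρ t x * deriv (deriv ζ) (ρ t x))) *
          ∑ i, Torus.partialDeriv i (fun y => u t y i) x) * α t x ^ 2 +
      1 / 2 * (2 / 3 * ζ (ρ t x) * (3 / 2 * ρ t x / θ t x) *
          ∑ i, Torus.partialDeriv i (fun y => u t y i) x) * β t x ^ 2 +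
      ∑ i, (Torus.partialDeriv i (θ t) x * (ζ (ρ t x) + ρ t x * deriv ζ (ρ t x)) +
            θ t x * (2 * deriv ζ (ρ t x) + ρ t x * deriv (deriv ζ) (ρ t x)) *
              Torus.partialDeriv i (ρ t) x) * α t x * w t x i +
      ∑ i, (ζ (ρ t x) + ρ t x * deriv ζ (ρ t x)) * Torus.partialDeriv i (ρ t) x * β t x * w t x i +
      θ t x * (ζ (ρ t x) + ρ t x * deriv ζ (ρ t x)) / ρ t x * α t x *
        (Torus.timeDerivWithin (Ico 0 T) α t x + ∑ i, u t x i * Torus.partialDeriv i (α t) x +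
          ρ t x * ∑ i, Torus.partialDeriv i (fun y => w t y i) x) +
      ρ t x * ∑ j, w t x j *
        (Torus.timeDerivWithin (Ico 0 T) (fun s y => w s y j) t x +
          ∑ i, u t x i * Torus.partialDeriv i (fun y => w t y j) x +
          θ t x * (ζ (ρ t x) + ρ t x * deriv ζ (ρ t x)) / ρ t x * Torus.partialDeriv j (α t) x +
          ζ (ρ t x) * Torus.partialDeriv j (β t) x) +
      3 / 2 * ρ t x / θ t x * β t x *
        (Torus.timeDerivWithin (Ico 0 T) β t x + ∑ i, u t x i * Torus.partialDeriv i (β t) x +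
          2 / 3 * (θ t x * ζ (ρ t x)) * ∑ i, Torus.partialDeriv i (fun y => w t y i) x) := by
  rw [hsEuler_frozen_energy_identity hE hJ hζ hρJ hα hw hβ ht x,
    hsEuler_weightA_transport hE hJ hζ hρJ hp ht x, hsEuler_weightB_transport hE hJ hζ hρJ hp ht x]
  simp only [hsEuler_coeffRho_partialDeriv hE hJ hζ hρJ ht x,
    hsEuler_coeffTheta_partialDeriv hE hJ hζ hρJ ht x]

end Explicit

section TwoEos

/-- **Relative-energy balance between solutions of two hard-sphere Euler systems (two equations
of state), pointwise.** Let `(ρ, u, θ)` solve the system with pressure `ρ θ ζ(ρ)` and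
`(ρ', u', θ')` the system with (possibly different `σ'` and) pressure `ρ' θ' ζ₂(ρ')`, `ζ, ζ₂`
smooth on open sets containing the values of `ρ, ρ'`. With the weights, energy density and fluxes
of `hsEuler_frozen_energy_identity` built from the FIRST solution and applied to
`(α, w, β) = (ρ - ρ', u - u', θ - θ')`:
`∂ₜe + Σᵢ ∂ᵢΦᵢ = Q + A α F_ρ + ρ Σⱼ wⱼ F_uⱼ + B β F_θ` with `Q` as in
`hsEuler_frozen_energy_identity_explicit` and the frozen operator of the difference EVALUATED
through both systems: `F_ρ = -(α div u' + w·∇ρ')`,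
`F_uⱼ = -(w·∇u'ⱼ + (θ γ(ρ)/ρ - θ' γ₂(ρ')/ρ') ∂ⱼρ' + (ζ(ρ) - ζ₂(ρ')) ∂ⱼθ')`,
`F_θ = -(w·∇θ' + (2/3)(θ ζ(ρ) - θ' ζ₂(ρ')) div u')` (`γ = ζ + id·ζ'`, `γ₂ = ζ₂ + id·ζ₂'`):
bilinear in the differences and the reference gradients `∇ρ', ∇u', ∇θ'`, plus the
equation-of-state defects `θγ(ρ)/ρ - θ'γ₂(ρ')/ρ'`, `ζ(ρ) - ζ₂(ρ')`, `θζ(ρ) - θ'ζ₂(ρ')` (for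
`ζ₂ = ζ` these are again small and one recovers `hsEuler_relativeEnergy_balance`; for the ideal
gas `ζ₂ ≡ 1` they are the `O(ρσ³)` forcing of the shadowing estimate). [folklore] -/
theorem hsEuler_relativeEnergy_balance_two_eos :
    ∀ {σ σ' T : ℝ} {ρ θ ρ' θ' : ℝ → T3 → ℝ} {u u' : ℝ → T3 → V3} {ζ ζ₂ : ℝ → ℝ} {J J₂ : Set ℝ},
    IsHardSphereEulerSolution σ T ρ u θ → IsHardSphereEulerSolution σ' T ρ' u' θ' →
    IsOpen J → IsOpen J₂ → ContDiffOn ℝ (⊤ : ℕ∞) ζ J → ContDiffOn ℝ (⊤ : ℕ∞) ζ₂ J₂ →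
    (∀ t ∈ Ico 0 T, ∀ x, ρ t x ∈ J) → (∀ t ∈ Ico 0 T, ∀ x, ρ' t x ∈ J₂) →
    (∀ t ∈ Ico 0 T, ∀ x, hsPressure σ (ρ t x) (θ t x) = ρ t x * θ t x * ζ (ρ t x)) →
    (∀ t ∈ Ico 0 T, ∀ x, hsPressure σ' (ρ' t x) (θ' t x) = ρ' t x * θ' t x * ζ₂ (ρ' t x)) →
    ∀ {t : ℝ}, t ∈ Ico 0 T → ∀ x : T3,
    Torus.timeDerivWithin (Ico 0 T) (fun s y => 1 / 2 *
        (θ s y * (ζ (ρ s y) + ρ s y * deriv ζ (ρ s y)) / ρ s y * (ρ s y - ρ' s y) ^ 2 +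
          ρ s y * ‖u s y - u' s y‖ ^ 2 + 3 / 2 * ρ s y / θ s y * (θ s y - θ' s y) ^ 2)) t x +
      ∑ i, Torus.partialDeriv i (fun y =>
        1 / 2 * (θ t y * (ζ (ρ t y) + ρ t y * deriv ζ (ρ t y)) / ρ t y * u t y i *
              (ρ t y - ρ' t y) ^ 2 +
            ρ t y * u t y i * ‖u t y - u' t y‖ ^ 2 +
            3 / 2 * ρ t y / θ t y * u t y i * (θ t y - θ' t y) ^ 2) +
          θ t y * (ζ (ρ t y) + ρ t y * deriv ζ (ρ t y)) * (ρ t y - ρ' t y) * (u t y i - u' t y i) +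
          ρ t y * ζ (ρ t y) * (θ t y - θ' t y) * (u t y i - u' t y i)) x =
      1 / 2 * ((θ t x * (ζ (ρ t x) + ρ t x * deriv ζ (ρ t x)) / ρ t x * (2 - 2 / 3 * ζ (ρ t x)) -
            θ t x * (2 * deriv ζ (ρ t x) + ρ t x * deriv (deriv ζ) (ρ t x))) *
          ∑ i, Torus.partialDeriv i (fun y => u t y i) x) * (ρ t x - ρ' t x) ^ 2 +
      1 / 2 * (2 / 3 * ζ (ρ t x) * (3 / 2 * ρ t x / θ t x) *
          ∑ i, Torus.partialDeriv i (fun y => u t y i) x) * (θ t x - θ' t x) ^ 2 +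
      ∑ i, (Torus.partialDeriv i (θ t) x * (ζ (ρ t x) + ρ t x * deriv ζ (ρ t x)) +
            θ t x * (2 * deriv ζ (ρ t x) + ρ t x * deriv (deriv ζ) (ρ t x)) *
              Torus.partialDeriv i (ρ t) x) * (ρ t x - ρ' t x) * (u t x i - u' t x i) +
      ∑ i, (ζ (ρ t x) + ρ t x * deriv ζ (ρ t x)) * Torus.partialDeriv i (ρ t) x *
          (θ t x - θ' t x) * (u t x i - u' t x i) +
      θ t x * (ζ (ρ t x) + ρ t x * deriv ζ (ρ t x)) / ρ t x * (ρ t x - ρ' t x) *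
        -((ρ t x - ρ' t x) * ∑ i, Torus.partialDeriv i (fun y => u' t y i) x +
            ∑ i, (u t x i - u' t x i) * Torus.partialDeriv i (ρ' t) x) +
      ρ t x * ∑ j, (u t x j - u' t x j) *
        -(∑ i, (u t x i - u' t x i) * Torus.partialDeriv i (fun y => u' t y j) x +
            (θ t x * (ζ (ρ t x) + ρ t x * deriv ζ (ρ t x)) / ρ t x -
                θ' t x * (ζ₂ (ρ' t x) + ρ' t x * deriv ζ₂ (ρ' t x)) / ρ' t x) *
              Torus.partialDeriv j (ρ' t) x +
            (ζ (ρ t x) - ζ₂ (ρ' t x)) * Torus.partialDeriv j (θ' t) x) +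
      3 / 2 * ρ t x / θ t x * (θ t x - θ' t x) *
        -(∑ i, (u t x i - u' t x i) * Torus.partialDeriv i (θ' t) x +
            2 / 3 * (θ t x * ζ (ρ t x) - θ' t x * ζ₂ (ρ' t x)) *
              ∑ i, Torus.partialDeriv i (fun y => u' t y i) x) := by
  intro σ σ' T ρ θ ρ' θ' u u' ζ ζ₂ J J₂ hE hE' hJ hJ₂ hζ hζ₂ hρJ hρJ' hp hp' t ht x
  have hU : UniqueDiffOn ℝ (Ico (0 : ℝ) T) := uniqueDiffOn_Ico 0 T
  -- the frozen identity for `W = V - V'`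
  have h := hsEuler_frozen_energy_identity_explicit (α := fun s y => ρ s y - ρ' s y)
    (w := fun s y => u s y - u' s y) (β := fun s y => θ s y - θ' s y) hE hJ hζ hρJ hp
    (hE.smooth_density.sub hE'.smooth_density) (hE.smooth_velocity.sub hE'.smooth_velocity)
    (hE.smooth_temperature.sub hE'.smooth_temperature) ht x
  simp only [PiLp.sub_apply] at h
  refine h.trans ?_
  clear h
  -- derivatives of the differences
  have hρ1 : Torus.IsContDiff 1 (ρ t) := (hE.smooth_density.isSmooth_slice ht).isContDiff (by simp)
  have hθ1 : Torus.IsContDiff 1 (θ t) :=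
    (hE.smooth_temperature.isSmooth_slice ht).isContDiff (by simp)
  have hu1 : Torus.IsContDiff 1 (u t) := (hE.smooth_velocity.isSmooth_slice ht).isContDiff (by simp)
  have hρ1' : Torus.IsContDiff 1 (ρ' t) :=
    (hE'.smooth_density.isSmooth_slice ht).isContDiff (by simp)
  have hθ1' : Torus.IsContDiff 1 (θ' t) :=
    (hE'.smooth_temperature.isSmooth_slice ht).isContDiff (by simp)
  have hu1' : Torus.IsContDiff 1 (u' t) :=
    (hE'.smooth_velocity.isSmooth_slice ht).isContDiff (by simp)
  have hdρ : Torus.timeDerivWithin (Ico 0 T) (fun s y => ρ s y - ρ' s y) t x =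
      Torus.timeDerivWithin (Ico 0 T) ρ t x - Torus.timeDerivWithin (Ico 0 T) ρ' t x :=
    timeDerivWithin_eq_of_hasDerivWithinAt ((hE.smooth_density.hasDerivWithinAt_slice ht x).fun_sub
      (hE'.smooth_density.hasDerivWithinAt_slice ht x)) (hU t ht)
  have hdθ : Torus.timeDerivWithin (Ico 0 T) (fun s y => θ s y - θ' s y) t x =
      Torus.timeDerivWithin (Ico 0 T) θ t x - Torus.timeDerivWithin (Ico 0 T) θ' t x :=
    timeDerivWithin_eq_of_hasDerivWithinAt
      ((hE.smooth_temperature.hasDerivWithinAt_slice ht x).fun_sub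
        (hE'.smooth_temperature.hasDerivWithinAt_slice ht x)) (hU t ht)
  have hdu : ∀ j, Torus.timeDerivWithin (Ico 0 T) (fun s y => u s y j - u' s y j) t x =
      Torus.timeDerivWithin (Ico 0 T) (fun s y => u s y j) t x -
        Torus.timeDerivWithin (Ico 0 T) (fun s y => u' s y j) t x := fun j =>
    timeDerivWithin_eq_of_hasDerivWithinAt
      (((hE.smooth_velocity.apply j).hasDerivWithinAt_slice ht x).fun_sub
        ((hE'.smooth_velocity.apply j).hasDerivWithinAt_slice ht x)) (hU t ht)
  have hgρ : ∀ i, Torus.partialDeriv i (fun y => ρ t y - ρ' t y) x =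
      Torus.partialDeriv i (ρ t) x - Torus.partialDeriv i (ρ' t) x := fun i =>
    partialDeriv_eq_of_hasDerivAt ((hasDerivAt_coordLine hρ1 x i).fun_sub
      (hasDerivAt_coordLine hρ1' x i))
  have hgθ : ∀ i, Torus.partialDeriv i (fun y => θ t y - θ' t y) x =
      Torus.partialDeriv i (θ t) x - Torus.partialDeriv i (θ' t) x := fun i =>
    partialDeriv_eq_of_hasDerivAt ((hasDerivAt_coordLine hθ1 x i).fun_sub
      (hasDerivAt_coordLine hθ1' x i))
  have hgu : ∀ i j, Torus.partialDeriv i (fun y => u t y j - u' t y j) x =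
      Torus.partialDeriv i (fun y => u t y j) x - Torus.partialDeriv i (fun y => u' t y j) x :=
    fun i j => partialDeriv_eq_of_hasDerivAt
      ((hasDerivAt_coordLine (isContDiff_apply_coord hu1 j) x i).fun_sub
        (hasDerivAt_coordLine (isContDiff_apply_coord hu1' j) x i))
  simp only [hdρ, hdθ, hdu, hgρ, hgθ, hgu]
  -- the primitive equations of both solutions
  have hP1 := hE.timeDeriv_density_eq ht x
  have hP1' := hE'.timeDeriv_density_eq ht x
  have hP2 := fun k => hE.density_mul_timeDeriv_velocity_eq hJ hζ hρJ hp ht x k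
  have hP3 := hE.timeDeriv_temperature_eq hJ hζ hρJ hp ht x
  have hP3' := hE'.timeDeriv_temperature_eq hJ₂ hζ₂ hρJ' hp' ht x
  have hρ0 : ρ t x ≠ 0 := (hE.density_pos t ht x).ne'
  have hρ0' : ρ' t x ≠ 0 := (hE'.density_pos t ht x).ne'
  have hV' : ∀ j, Torus.timeDerivWithin (Ico 0 T) (fun s y => u' s y j) t x =
      -(∑ i, u' t x i * Torus.partialDeriv i (fun y => u' t y j) x) -
        (θ' t x * (ζ₂ (ρ' t x) + ρ' t x * deriv ζ₂ (ρ' t x)) / ρ' t x *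
            Torus.partialDeriv j (ρ' t) x +
          ζ₂ (ρ' t x) * Torus.partialDeriv j (θ' t) x) := by
    intro j
    rw [← mul_right_inj' hρ0', hE'.density_mul_timeDeriv_velocity_eq hJ₂ hζ₂ hρJ' hp' ht x j]
    field_simp
  have hA : θ t x * (ζ (ρ t x) + ρ t x * deriv ζ (ρ t x)) / ρ t x * ρ t x =
      θ t x * (ζ (ρ t x) + ρ t x * deriv ζ (ρ t x)) := div_mul_cancel₀ _ hρ0
  have hP20 := hP2 0
  have hP21 := hP2 1
  have hP22 := hP2 2
  have hV0 := hV' 0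
  have hV1 := hV' 1
  have hV2 := hV' 2
  simp only [Fin.sum_univ_three] at hP1 hP1' hP20 hP21 hP22 hV0 hV1 hV2 hP3 hP3' ⊢
  linear_combination
    θ t x * (ζ (ρ t x) + ρ t x * deriv ζ (ρ t x)) / ρ t x * (ρ t x - ρ' t x) * hP1 -
    θ t x * (ζ (ρ t x) + ρ t x * deriv ζ (ρ t x)) / ρ t x * (ρ t x - ρ' t x) * hP1' +
    (u t x 0 - u' t x 0) * hP20 + (u t x 1 - u' t x 1) * hP21 + (u t x 2 - u' t x 2) * hP22 -
    ρ t x * (u t x 0 - u' t x 0) * hV0 - ρ t x * (u t x 1 - u' t x 1) * hV1 -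
    ρ t x * (u t x 2 - u' t x 2) * hV2 +
    3 / 2 * ρ t x / θ t x * (θ t x - θ' t x) * hP3 -
    3 / 2 * ρ t x / θ t x * (θ t x - θ' t x) * hP3' +
    ((u t x 0 - u' t x 0) * Torus.partialDeriv 0 (ρ t) x +
      (u t x 1 - u' t x 1) * Torus.partialDeriv 1 (ρ t) x +
      (u t x 2 - u' t x 2) * Torus.partialDeriv 2 (ρ t) x) * hA

end TwoEos

end HsEulerStability

end Literature.MathematicalPhysics.KineticTheory

end
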